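import Summits.BirchSwinnertonDyer.BirchSwinnertonDyer.Theorems.ErratumRoadFiveNonSurjCornerTwinMuAnUnitDerivative
import Summits.BirchSwinnertonDyer.BirchSwinnertonDyer.Theorems.ErratumRoadFiveNonSurjCornerTwinMuAnUnitValueBSD
import Summits.BirchSwinnertonDyer.BirchSwinnertonDyer.Theorems.ErratumRoadFiveNonSurjCornerSevenInstanceT54o7
import Literature.NumberTheory.EllipticCurves.PAdicHeightsTateValuationProofs
import Literature.NumberTheory.EllipticCurves.CanonicalPAdicHeightIntegralityProofs
import Literature.NumberTheory.EllipticCurves.CanonicalPAdicHeightRestrictionProofs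
import HarnessLib

/-!
# Route `ErratumRoadFive` (rung K2), crux child `NonSurjCornerTwinMuAn` (item stmt-BirchSwinnertonDyer-19948, parent
# 19065 `NonSurjCorner`): the SPLIT branch — THE LINEAR COEFFICIENT OF `ϖ·L` IN BSD INVARIANTS, and why it is NOT the
# certificate on the corner: `‖[T¹](ϖ·L)‖_p = p·‖log_p q_E‖_p·‖#Ш_an‖_p` when `p` is the only split place, and
# `q_E ∈ (ℚ_p^×)^p` (the corner's image) forces `‖log_p q_E‖_p ≤ p⁻²` (cell `bsd-stepL`, seat `bsd-stepL-corner5-p2` g6,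
# WIDTH-LEVER lane B; `--supports stmt-BirchSwinnertonDyer-19948 --as helper`)

WHAT. This seat's `…TwinMuAnUnitDerivative` (p578622) gives on the split branch (`a = a_p = +1`) the exact identity
`‖[T¹](ϖ·L)‖_p = p·‖ϖ·𝓛_p(Wd)·[0]⁺_f‖_p` (Greenberg–Stevens by name), and `…TwinMuAnUnitValueBSD` (p583299) the rank-0
identity `ϖ·[0]⁺_f = #Ш(Wd)_an·∏c/#tors²`. Here the two are combined with `𝓛_p = log_p q / ord_p q`
(`WeierstrassCurve.LInvariant`), `ord_p q = ord_p Δ_min` (`TateParameterData.valuation_q_eq_padicValInt_holds`) and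
`c_p = ord_p Δ_min` at the split place (g4's `tamagawaNumberAt_eq_ordMinimalDiscriminant_of_split`): when `p` is the ONLY split
multiplicative place of the twin, the denominator `ord_p q` of the `𝓛`-invariant CANCELS against the Tamagawa number `c_p`, and

  **`‖[T¹](ϖ·L)‖_p = p · ‖log_p q_E‖_p · ‖#Ш(Wd)_an‖_p`** (§2).

So the linear coefficient is a `p`-adic unit iff `‖log_p q_E‖ = p^{ord_p #Ш_an − 1}`; for a `p`-integral `#Ш_an` this is
Skinner–Zhang's hypothesis «`log_p q_E ∈ pℤ_p^×`» ([SZ14] Thm. 1.1 (b) ∕ Thm. 1.3 (c)). But on the corner the Tate parameter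
is a `p`-th POWER in `ℚ_p^×` (this lane's g3, `NonSurjCorner.exists_pow_eq_tateParameter`: the image of `ρ̄_{E,p}` has order
prime to `p`, so `0 → μ_p → E_q[p] → ℤ/p → 0` splits; the same holds for the X11a twins, whose image is the twist of the
corner pair's by a quadratic character), and for `q = r^p` one has `log_p q = p·log_p r` with `‖log_p r‖ ≤ p⁻¹` (`p` odd), so
`‖log_p q‖ ≤ p⁻²` (§1) and

  **`‖[T¹](ϖ·L)‖_p ≤ p⁻¹·‖#Ш(Wd)_an‖_p`** (§3): a unit LINEAR coefficient would force `ord_p #Ш(Wd)_an ≤ −1`.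

Hence, granted that `#Ш_an` of the twin is `p`-integral, the analytic μ = 0 certificate of the split stub `stub_twinMuAn_split` sits
at an index `n ≥ 2` (§3, `two_le_of_norm_coeff_eq_one`): `[T⁰] = 0` (exceptional zero) and `[T¹]` is never a unit. The
`p`-th-power hypothesis is carried as the explicit, per-pair decidable binder `hpow : ∃ r, r ^ p = Dq.q` (it is g3's theorem
read in `ℚ_[p]`; the transport `v.adicCompletion ℚ ≃ ℚ_[p]` of that theorem is not redone here).

* §1 `MuAnUnit.norm_padicLog_pow_prime_le` — `‖log_p(r^p)‖ ≤ p⁻²` (`p` odd; tree `padicLog_pow`, `norm_padicLog_le_inv`).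
* §2 **`MuAnUnit.norm_coeff_one_C_mul_eq_bsd`** — the displayed identity (GZK + Greenberg–Stevens by name, `p` the unique split place).
* §3 **`MuAnUnit.norm_coeff_one_C_mul_le_of_pow`**, `MuAnUnit.padicValRat_shaAn_le_of_norm_coeff_one_eq_one`,
  **`MuAnUnit.two_le_of_norm_coeff_eq_one`**.

HONEST FRAMING: theorems only (no definition, no named fact, no `sorry`); CONDITIONAL on GZK and Greenberg–Stevens (published, by
name) and on the displayed per-twin binders; a structural statement about WHERE the split-branch certificate can sit, not a
certificate; 19948 does NOT close; BSD is advanced for no class (T7).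
References: [Kobayashi2006DocMath] Cor. 4.2; [GreenbergStevens1993] Thm. 7.1; [MazurTateTeitelbaum1986Invent] §I.15, §II.1;
[SkinnerZhang2014] arXiv:1407.1099 Thm. 1.1 (b), Thm. 1.3 (c) (`log_p q_E ∈ pℤ_p^×`); [Iwasawa1972PadicL] §4.4; [Miller2011LMS] §1;
tree: p578622, p583299, g3's `…NonSurjCornerTateParameter` (p-th power), g4's `…TamagawaCarriers`.
-/

set_option autoImplicit false
set_option linter.dupNamespace false

noncomputable section

open scoped Classical NumberField MatrixGroups ModularForm

namespace Summit.BirchSwinnertonDyer.Rank1Residual.X11b.MuAnUnit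

open CongruenceSubgroup WeierstrassCurve Literature.NumberTheory.EllipticCurves
  Literature.NumberTheory.EllipticCurves.ModularForms Literature.NumberTheory.EllipticCurves.Rank1Residual
  Summit.BirchSwinnertonDyer.Rank1Residual IsDedekindDomain

variable {N : ℕ} [NeZero N] {f : CuspForm (Gamma0 N) 2} {p : ℕ} [Fact p.Prime]
  {Wd : WeierstrassCurve ℚ} [Wd.IsElliptic] [Wd.IsGloballyMinimal]

/-! ### §1 The Iwasawa logarithm of a `p`-th power -/

omit [NeZero N] in
/-- **`‖log_p(r^p)‖_p ≤ p⁻²` for `p` odd** (`log_p(r^p) = p·log_p r`, `‖log_p r‖ ≤ p⁻¹`). [cite: Iwasawa1972PadicL, §4.4] -/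
theorem norm_padicLog_pow_prime_le (hp2 : p ≠ 2) {r : ℚ_[p]} (hr : r ≠ 0) :
    ‖padicLog p (r ^ p)‖ ≤ (p : ℝ)⁻¹ * (p : ℝ)⁻¹ := by
  rw [padicLog_pow p hr p, norm_mul, Padic.norm_p]
  exact mul_le_mul_of_nonneg_left (norm_padicLog_le_inv hp2 r) (by positivity)

/-! ### §2 The linear coefficient in BSD invariants -/

/-- **`‖[T¹](ϖ·L)‖_p = p·‖log_p q_E‖_p·‖#Ш(Wd)_an‖_p`** on an X11a twin (`r_an = 0`, `p ≥ 5`, `E[p]` irreducible) with Tate datum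
`Dq` at the SPLIT prime `p`, `p` the ONLY split multiplicative place (`huniq`), newform `f`, period ratio `ϖ`, `L` with
`IsMultPAdicLFunctionOf f p 1 L`, `shaAn Wd = q ≠ 0`; modulo GZK (`hGZK`) and Greenberg–Stevens (`hGS`) by name. The `𝓛`-invariant's
denominator `ord_p q = ord_p Δ_min = c_p` cancels against the Tamagawa number at `p`, `#tors` is prime to `p`.
[cite: Kobayashi2006DocMath, Cor. 4.2 (p. 575)] [cite: MazurTateTeitelbaum1986Invent, §II.1] [cite: SilvermanATAEC1994, Cor. IV.9.2 (d)] -/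
theorem norm_coeff_one_C_mul_eq_bsd (hp2 : p ≠ 2) (hp5 : 5 ≤ p) (hGZK : rank_eq_analyticRank_of_analyticRank_le_one)
    (hXa : ClassX11a Wd p) (hGS : greenberg_stevens (W := Wd) (p := p)) (Dq : TateParameterData Wd p)
    (huniq : ∀ v : HeightOneSpectrum (𝓞 ℚ), Wd.HasSplitMultiplicativeReductionAt v →
      v = (Rat.HeightOneSpectrum.primesEquiv (R := 𝓞 ℚ)).symm ⟨p, Fact.out⟩)
    (hf : IsNewformOf Wd f) {ϖ : ℚ} (hϖ : (ϖ : ℝ) * Wd.realPeriodRat = plusPeriod f)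
    {L : PowerSeries ℚ_[p]} (hL : IsMultPAdicLFunctionOf f p 1 L) {q : ℚ} (hq : shaAn Wd = (q : ℂ)) (hq0 : q ≠ 0) :
    ‖PowerSeries.coeff 1 (PowerSeries.C ((ϖ : ℚ) : ℚ_[p]) * L)‖ =
      (p : ℝ) * (‖padicLog p Dq.q‖ * ‖((q : ℚ) : ℚ_[p])‖) := by
  -- the place of `p` and the split reduction there
  set v₀ : HeightOneSpectrum (𝓞 ℚ) := (Rat.HeightOneSpectrum.primesEquiv (R := 𝓞 ℚ)).symm ⟨p, Fact.out⟩ with hv₀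
  have hpv : ((Rat.HeightOneSpectrum.primesEquiv v₀ : Nat.Primes) : ℕ) = p := by rw [hv₀, Equiv.apply_symm_apply]
  have hs₀ : Wd.HasSplitMultiplicativeReductionAt v₀ :=
    (Wd.hasSplitMultiplicativeReductionAtPrime_iff_hasSplitMultiplicativeReductionAt v₀).mp
      (Summit.BirchSwinnertonDyer.BirchSwinnertonDyer.Theorems.CornerSeven.T54o7.hasSplitMultiplicativeReductionAtPrime_of_eq
        hpv.symm Dq.split)
  -- `ord_p Tam = ord_p c_p = ord_p (ord_p Δ_min)`
  set e : ℕ := padicValInt p Wd.minimalDiscriminantInt with he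
  have hTam : padicValNat p Wd.tamagawaProduct = padicValNat p e := by
    rw [← Summit.BirchSwinnertonDyer.BirchSwinnertonDyer.Theorems.CornerLocal.padicValNat_tamagawaNumberAt_eq_of_unique_split
      Wd p hp5 hs₀ huniq,
      Summit.BirchSwinnertonDyer.BirchSwinnertonDyer.Theorems.CornerLocal.tamagawaNumberAt_eq_ordMinimalDiscriminant_of_split Wd hs₀,
      Summit.BirchSwinnertonDyer.BirchSwinnertonDyer.Theorems.CornerLocal.ordMinimalDiscriminant_eq_padicValInt_primesEquiv Wd v₀,
      hpv]
  -- `ord_p q = ord_p Δ_min = e ≥ 1`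
  have hval : Dq.q.valuation = (e : ℤ) := TateParameterData.valuation_q_eq_padicValInt_holds Dq
  have he0 : e ≠ 0 := by
    intro h0
    have := Dq.valuation_q_pos
    rw [hval, h0] at this
    simp at this
  have heQ : ((e : ℚ) : ℚ_[p]) = (Dq.q.valuation : ℚ_[p]) := by rw [hval]; push_cast; rfl
  have heQ0 : (e : ℚ) ≠ 0 := by exact_mod_cast he0
  -- tors is prime to `p`
  have ht0 : padicValNat p Wd.torsionOrder = 0 := padicValNat_torsionOrder_eq_zero_of_irreducible Wd p hXa.2.2.2.1
  have htq : (Wd.torsionOrder : ℚ) ≠ 0 := by exact_mod_cast (Wd.torsionOrder_pos_holds).ne'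
  have hcq : (Wd.tamagawaProduct : ℚ) ≠ 0 := by exact_mod_cast (Wd.tamagawaProduct_pos').ne'
  -- `ϖ·[0]⁺ = q·Tam/tors²`
  have hid := varpi_mul_ratPlusSymbol_eq hGZK hXa.1 hf hϖ hq
  -- the rational `s = q·Tam/(tors²·e)` and its valuation `= ord_p q`
  set s : ℚ := q * Wd.tamagawaProduct / (Wd.torsionOrder : ℚ) ^ 2 / e with hs
  have hs0 : s ≠ 0 := div_ne_zero (div_ne_zero (mul_ne_zero hq0 hcq) (pow_ne_zero 2 htq)) heQ0
  have hvs : padicValRat p s = padicValRat p q := by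
    rw [hs, padicValRat.div (div_ne_zero (mul_ne_zero hq0 hcq) (pow_ne_zero 2 htq)) heQ0,
      padicValRat.div (mul_ne_zero hq0 hcq) (pow_ne_zero 2 htq), padicValRat.mul hq0 hcq, padicValRat.pow,
      show (Wd.tamagawaProduct : ℚ) = ((Wd.tamagawaProduct : ℕ) : ℚ) by norm_cast, padicValRat.of_nat, hTam,
      show (Wd.torsionOrder : ℚ) = ((Wd.torsionOrder : ℕ) : ℚ) by norm_cast, padicValRat.of_nat, ht0,
      show (e : ℚ) = ((e : ℕ) : ℚ) by norm_cast, padicValRat.of_nat]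
    push_cast; ring
  have hns : ‖((s : ℚ) : ℚ_[p])‖ = ‖((q : ℚ) : ℚ_[p])‖ := by
    rw [Padic.eq_padicNorm, Padic.eq_padicNorm, padicNorm.eq_zpow_of_nonzero hs0, padicNorm.eq_zpow_of_nonzero hq0, hvs]
  -- rewrite `ϖ·𝓛·[0]⁺ = log_p q · s`
  have hkey : ((ϖ : ℚ) : ℚ_[p]) * LInvariant Dq * (ratPlusSymbol f 0 : ℚ_[p]) = padicLog p Dq.q * ((s : ℚ) : ℚ_[p]) := by
    have hϖs : ((ϖ : ℚ) : ℚ_[p]) * (ratPlusSymbol f 0 : ℚ_[p]) = (((q * Wd.tamagawaProduct / (Wd.torsionOrder : ℚ) ^ 2 : ℚ)) : ℚ_[p]) := by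
      rw [← Rat.cast_mul, hid]
    have heP : (Dq.q.valuation : ℚ_[p]) ≠ 0 := by rw [← heQ]; exact_mod_cast heQ0
    rw [WeierstrassCurve.LInvariant, hs]
    rw [show ((q * ↑Wd.tamagawaProduct / (Wd.torsionOrder : ℚ) ^ 2 / (e : ℚ) : ℚ) : ℚ_[p]) =
        ((q * ↑Wd.tamagawaProduct / (Wd.torsionOrder : ℚ) ^ 2 : ℚ) : ℚ_[p]) / ((e : ℚ) : ℚ_[p]) by push_cast; ring,
      ← hϖs, heQ]
    field_simp
  rw [norm_coeff_one_C_mul_of_one hp2 hGS Dq hf hL, hkey, norm_mul, hns]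

/-! ### §3 A `p`-th power Tate parameter: the linear coefficient is never the certificate -/

/-- **`‖[T¹](ϖ·L)‖_p ≤ p⁻¹·‖#Ш(Wd)_an‖_p`** under the hypotheses of `norm_coeff_one_C_mul_eq_bsd` PLUS «the Tate parameter is a
`p`-th power in `ℚ_p`» (`hpow` — on the corner and its twins this is g3's `NonSurjCorner.exists_pow_eq_tateParameter`, image of
order prime to `p`). [cite: SkinnerZhang2014, Thm. 1.3 (c)] [cite: Iwasawa1972PadicL, §4.4] -/
theorem norm_coeff_one_C_mul_le_of_pow (hp2 : p ≠ 2) (hp5 : 5 ≤ p) (hGZK : rank_eq_analyticRank_of_analyticRank_le_one)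
    (hXa : ClassX11a Wd p) (hGS : greenberg_stevens (W := Wd) (p := p)) (Dq : TateParameterData Wd p)
    (hpow : ∃ r : ℚ_[p], r ^ p = Dq.q)
    (huniq : ∀ v : HeightOneSpectrum (𝓞 ℚ), Wd.HasSplitMultiplicativeReductionAt v →
      v = (Rat.HeightOneSpectrum.primesEquiv (R := 𝓞 ℚ)).symm ⟨p, Fact.out⟩)
    (hf : IsNewformOf Wd f) {ϖ : ℚ} (hϖ : (ϖ : ℝ) * Wd.realPeriodRat = plusPeriod f)
    {L : PowerSeries ℚ_[p]} (hL : IsMultPAdicLFunctionOf f p 1 L) {q : ℚ} (hq : shaAn Wd = (q : ℂ)) (hq0 : q ≠ 0) :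
    ‖PowerSeries.coeff 1 (PowerSeries.C ((ϖ : ℚ) : ℚ_[p]) * L)‖ ≤ (p : ℝ)⁻¹ * ‖((q : ℚ) : ℚ_[p])‖ := by
  obtain ⟨r, hr⟩ := hpow
  have hr0 : r ≠ 0 := by rintro rfl; exact Dq.q_ne_zero (by rw [← hr, zero_pow (Fact.out : p.Prime).ne_zero])
  have hlog : ‖padicLog p Dq.q‖ ≤ (p : ℝ)⁻¹ * (p : ℝ)⁻¹ := by rw [← hr]; exact norm_padicLog_pow_prime_le hp2 hr0
  have hp0 : (0 : ℝ) < p := by exact_mod_cast (Fact.out : p.Prime).pos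
  rw [norm_coeff_one_C_mul_eq_bsd hp2 hp5 hGZK hXa hGS Dq huniq hf hϖ hL hq hq0]
  calc (p : ℝ) * (‖padicLog p Dq.q‖ * ‖((q : ℚ) : ℚ_[p])‖)
      ≤ (p : ℝ) * ((p : ℝ)⁻¹ * (p : ℝ)⁻¹ * ‖((q : ℚ) : ℚ_[p])‖) :=
        mul_le_mul_of_nonneg_left (mul_le_mul_of_nonneg_right hlog (norm_nonneg _)) hp0.le
    _ = (p : ℝ)⁻¹ * ‖((q : ℚ) : ℚ_[p])‖ := by field_simp

/-- **A unit linear coefficient forces `ord_p #Ш(Wd)_an ≤ −1`** (same hypotheses): `1 = ‖[T¹](ϖ·L)‖ ≤ p⁻¹·p^{−ord_p q}`.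
[cite: SkinnerZhang2014, Thm. 1.3 (c)] [cite: Miller2011LMS, §1] -/
theorem padicValRat_shaAn_le_of_norm_coeff_one_eq_one (hp2 : p ≠ 2) (hp5 : 5 ≤ p)
    (hGZK : rank_eq_analyticRank_of_analyticRank_le_one) (hXa : ClassX11a Wd p)
    (hGS : greenberg_stevens (W := Wd) (p := p)) (Dq : TateParameterData Wd p) (hpow : ∃ r : ℚ_[p], r ^ p = Dq.q)
    (huniq : ∀ v : HeightOneSpectrum (𝓞 ℚ), Wd.HasSplitMultiplicativeReductionAt v →
      v = (Rat.HeightOneSpectrum.primesEquiv (R := 𝓞 ℚ)).symm ⟨p, Fact.out⟩)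
    (hf : IsNewformOf Wd f) {ϖ : ℚ} (hϖ : (ϖ : ℝ) * Wd.realPeriodRat = plusPeriod f)
    {L : PowerSeries ℚ_[p]} (hL : IsMultPAdicLFunctionOf f p 1 L) {q : ℚ} (hq : shaAn Wd = (q : ℂ)) (hq0 : q ≠ 0)
    (h1 : ‖PowerSeries.coeff 1 (PowerSeries.C ((ϖ : ℚ) : ℚ_[p]) * L)‖ = 1) : padicValRat p q ≤ -1 := by
  have hle := norm_coeff_one_C_mul_le_of_pow hp2 hp5 hGZK hXa hGS Dq hpow huniq hf hϖ hL hq hq0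
  rw [h1, Padic.eq_padicNorm, padicNorm.eq_zpow_of_nonzero hq0] at hle
  push_cast at hle
  have hp1 : (1 : ℝ) < p := by exact_mod_cast (Fact.out : p.Prime).one_lt
  -- `1 ≤ p⁻¹ · p^{-v}` means `p^1 ≤ p^{-v}`, i.e. `1 ≤ -v`
  have h' : (p : ℝ) ^ (1 : ℤ) ≤ (p : ℝ) ^ (-padicValRat p q) := by
    rw [zpow_one]
    have hp0 : (0 : ℝ) < p := by linarith
    calc (p : ℝ) = p * 1 := (mul_one _).symm
      _ ≤ p * ((p : ℝ)⁻¹ * (p : ℝ) ^ (-padicValRat p q)) := mul_le_mul_of_nonneg_left hle hp0.le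
      _ = (p : ℝ) ^ (-padicValRat p q) := by field_simp
  have := (zpow_le_zpow_iff_right₀ hp1).mp h'
  omega

/-- **On the split branch the certificate index is at least `2`** (same hypotheses, plus `ord_p #Ш(Wd)_an ≥ 0`): if
`‖[Tⁿ](ϖ·L)‖ = 1` then `2 ≤ n` — `[T⁰] = 0` is the exceptional zero and `[T¹]` is not a unit. [cite: MazurTateTeitelbaum1986Invent, §I.15]
[cite: SkinnerZhang2014, Thm. 1.3 (c)] -/
theorem two_le_of_norm_coeff_eq_one (hp2 : p ≠ 2) (hp5 : 5 ≤ p) (hGZK : rank_eq_analyticRank_of_analyticRank_le_one)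
    (hXa : ClassX11a Wd p) (hGS : greenberg_stevens (W := Wd) (p := p)) (Dq : TateParameterData Wd p)
    (hpow : ∃ r : ℚ_[p], r ^ p = Dq.q)
    (huniq : ∀ v : HeightOneSpectrum (𝓞 ℚ), Wd.HasSplitMultiplicativeReductionAt v →
      v = (Rat.HeightOneSpectrum.primesEquiv (R := 𝓞 ℚ)).symm ⟨p, Fact.out⟩)
    (hf : IsNewformOf Wd f) {ϖ : ℚ} (hϖ : (ϖ : ℝ) * Wd.realPeriodRat = plusPeriod f)
    {L : PowerSeries ℚ_[p]} (hL : IsMultPAdicLFunctionOf f p 1 L) {q : ℚ} (hq : shaAn Wd = (q : ℂ)) (hq0 : q ≠ 0)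
    (hint : 0 ≤ padicValRat p q) {n : ℕ} (hn : ‖PowerSeries.coeff n (PowerSeries.C ((ϖ : ℚ) : ℚ_[p]) * L)‖ = 1) : 2 ≤ n := by
  rcases Nat.lt_or_ge n 2 with hlt | hge
  · exfalso
    interval_cases n
    · rw [coeff_zero_C_mul_of_one hL, norm_zero] at hn; exact zero_ne_one hn
    · have := padicValRat_shaAn_le_of_norm_coeff_one_eq_one hp2 hp5 hGZK hXa hGS Dq hpow huniq hf hϖ hL hq hq0 hn
      omega
  · exact hge

end Summit.BirchSwinnertonDyer.Rank1Residual.X11b.MuAnUnit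

end
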